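import Summits.Schanuel.Schanuel.Theses.RoyCriterion
import Literature.NumberTheory.Transcendental.RoySmallValueMain
import Summits.Schanuel.Schanuel.Theorems.RoyCriterionRoySmallValueDirichletGapDefs
import Summits.Schanuel.Schanuel.Theorems.RoyCriterionRoySmallValueDirichletGapStubTangentialTowerEmptinessFree

/-!
# Route `RoyCriterion`, crux `RoySmallValueDirichletGap` (stmt-Schanuel-1050), line
# `two-sided-absorption-transfer` — no finite tower of enemies (support for the open stub
# `stub_tangentialTowerEmptiness`)

`no_finite_tower`: for `τ < β + δ` no point `(ξ, η)` carries enemy links (`IsLink`, Defs file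
`RoyCriterionRoySmallValueDirichletGapDefs.lean`) at every large level whose point sets all lie in one
fixed finite set — the global form of the mortality of enemies (`IsLink.exists_pdist_le` of
`…StubTangentialTowerEmptinessFree.lean`: a point of the link lies within `exp(−D^{δ+β−τ}/C)` of
`(1:γ)`).  Hence along any would-be tangential tower the enemies run through infinitely many distinct
algebraic points; Roy 2013 §7 uses this only implicitly (`D* → ∞`, Step 3).

References: D. Roy, *A small value estimate for 𝔾ₐ × 𝔾ₘ*, Mathematika 59 (2013) = arXiv:1301.0663,
§7 Steps 2–3.
-/

-- `Summit.Schanuel.Schanuel.…` is the mandated layout of this single-problem summit (CONVENTIONS §1).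
set_option linter.dupNamespace false

noncomputable section

namespace Summit.Schanuel.Schanuel.Theorems.RoyLinks

open Filter MvPolynomial Finset Height
open Literature.NumberTheory.Transcendental
open Literature.NumberTheory.Transcendental.Roy2013
open Summit.Schanuel.Schanuel.Theses.RoyCriterion (RoySmallValueDirichletGap)

/-! ## No finite towers (mortality made global) -/

/-- **No finite tower of enemies**: if `τ < β + δ`, no point carries links at every large level whose
point sets all lie in one FIXED finite set `Q` — by `IsLink.exists_pdist_le` some point of `Q` at
positive distance from `(1:γ)` would have to be within `exp(−D^{δ+β−τ}/C)` of it for all large `D`.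
(So along any tower the enemies `P_D` run through infinitely many distinct points; Roy 2013 §7 uses
this only implicitly, through `D* → ∞`.) [cite: Roy2013, §7, Steps 2–3] -/
theorem no_finite_tower {ξ η : ℂ} {β τ δ : ℝ} (hτ : 0 ≤ τ) (hτβ : τ < δ + β)
    (Q : Finset (Fin 3 → ℂ)) :
    ¬ ∃ C : ℝ, 0 < C ∧ ∀ᶠ D : ℕ in atTop, ∃ (P : Finset (Fin 3 → ℂ)) (h : ℝ) (Ds : ℕ),
        IsLink C ξ η β τ δ D P h Ds ∧ P ⊆ Q := by
  classical
  rintro ⟨C, hC, hev⟩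
  -- the points of `Q` at positive distance from `(1:γ)` and their minimal distance
  set S := Q.filter (fun q => 0 < pdist ξ η (supNormalise q)) with hS
  have key : ∀ᶠ D : ℕ in atTop, ∃ q ∈ S,
      pdist ξ η (supNormalise q) ≤ Real.exp (-((D : ℝ) ^ (δ + β - τ) / C)) := by
    filter_upwards [hev] with D hD
    obtain ⟨P, h, Ds, hL, hPQ⟩ := hD
    obtain ⟨p, hp, hle⟩ := hL.exists_pdist_le hτ
    exact ⟨p, mem_filter.mpr ⟨hPQ hp, hL.2.2.1 p hp⟩, hle⟩
  rcases S.eq_empty_or_nonempty with hSe | hSne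
  · obtain ⟨D, hD⟩ := key.exists
    obtain ⟨q, hq, -⟩ := hD
    rw [hSe] at hq
    exact absurd hq (Finset.notMem_empty q)
  · set ρ₀ := S.inf' hSne (fun q => pdist ξ η (supNormalise q)) with hρ₀
    have hρ₀pos : 0 < ρ₀ := by
      rw [hρ₀, Finset.lt_inf'_iff]
      intro q hq
      exact (mem_filter.mp hq).2
    have hsmall := eventually_exp_neg_lt (κ := 1 / C) (e := δ + β - τ) (by positivity) (by linarith) hρ₀pos
    obtain ⟨D, ⟨q, hq, hle⟩, hlt⟩ := (key.and hsmall).exists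
    have hmin : ρ₀ ≤ pdist ξ η (supNormalise q) := Finset.inf'_le _ hq
    have e : Real.exp (-((D : ℝ) ^ (δ + β - τ) / C)) = Real.exp (-(1 / C * (D : ℝ) ^ (δ + β - τ))) := by
      congr 1; ring
    rw [e] at hle
    linarith

end Summit.Schanuel.Schanuel.Theorems.RoyLinks

end
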